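import Summits.CriticalPhenomena.PercolationContinuityZ3.Theorems.Transplant.PlanarSkeletonSign1
import HarnessLib

/-!
# N1 (the {±1} node), R0 statement file: THE SINGLE-TYPE NEG NODE `SamePDropOfSkeletonNeg₁` — `SamePDropOfSkeletonNeg` (p244708's sibling, central
# inversion only, NO axis flip) restricted to skeletons with ONE base vertex type (`Φ.types = {t}`, hypothesis form), the TARGET OF RECORD of the N1
# programme (NEG-SCOPE.md §4.1: single-type first — the equilibrium data of Martineau–Tassion depend on the seed's type); its minimal / critical forms,
# the subexponential entry point, and its place between the landed nodes (`SamePDropOfSkeletonNeg → …Neg₁ → SamePDropOfSkeletonSign₁`)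

builds on p205010 (kernel theorem, internal audit signed; external expert review pending) — nothing in this file uses p205010; NOTHING is claimed about
the node (it is OPEN; V112's over-claim guard T5).
Lane `prim-bschramm`, seat `prim-bschramm-p3` (gen 8; design owner); helper file (`--supports stmt-CriticalPhenomena-4575`); twin of `PlanarSkeletonSign1` (p251543).
* `SamePDropOfSkeletonNeg₁`; `samePDropOfSkeletonNeg₁_of_neg` (the full Neg node implies it), `samePDropOfSkeletonSign₁_of_neg₁` (it implies the CLOSED single-type
  Sign node — forget the flip);
* `samePDropOfSkeletonNeg₁_iff_critical`, `samePDropOfSkeletonNeg₁_iff_minimal'` (↔ `∀ G Φ, ∀ t ∈ types, types = {t} → Φ2(p_c) → θ_t(p_c) = 0`);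
* **`samePDropOfSkeletonNeg₁_of_subexponential_case'`** (Hutchcroft off exponential growth — the entry point of the N1 closure);
* `continuity_of_negNode₁` (the instances' one-liner).
[cite: BenjaminiSchramm1996, Conj. 4] [cite: Hutchcroft2016, Thm. 1] [cite: LyonsPeres2016, Thm. 7.6] [cite: MartineauTassion2017, §3.2 (the LEVEL-0 source of the programme)]
-/

noncomputable section

namespace Summit.CriticalPhenomena.PercolationContinuityZ3.Theorems.Transplant

open MeasureTheory Literature.Probability.Percolation Literature.Probability.LatticeModels SimpleGraph
open Literature.Barriers.CriticalPhenomena (IsQuasiTransitive countable_of_connected_of_locallyFinite)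
open Literature.Barriers.CriticalPhenomena (HasExponentialGrowth Hutchcroft2016_noPercolationAtCriticality_holds IsGraphAmenable
  hasExponentialGrowth_of_not_isGraphAmenable BurtonKeane1989_atMostOneInfiniteCluster_holds)
open scoped Classical

/-- **THE SINGLE-TYPE NEG NODE** (target of record of N1): on a connected locally finite graph with a `PlanarSkeletonNeg` (translating frames, the
central inversion at each base vertex, unit steps, connected cylinders — NO axis flip) having ONE base vertex type, at every density `p < 1` with a.s.
uniqueness, subcritical cylinders and `θ_t(p) > 0`, some `q < p` still has `θ_t(q) > 0`.  Same body as `SamePDropOfSkeletonNeg` with the extra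
hypothesis `Φ.types = {t}`; implied by that node (`samePDropOfSkeletonNeg₁_of_neg`), implies the closed `SamePDropOfSkeletonSign₁`
(`samePDropOfSkeletonSign₁_of_neg₁`).  A conjecture node of THIS programme (OPEN; to be closed by the N1 chain of NEG-SCOPE.md), not a published fact —
the special case of Benjamini–Schramm's Conjecture 4 it expresses is cited on the theorems below. [this work] -/
@[conjecture] def SamePDropOfSkeletonNeg₁ : Prop :=
  ∀ {V : Type} [DecidableEq V] [Countable V] (G : SimpleGraph V) [G.LocallyFinite] (Φ : PlanarSkeletonNeg G),
    G.Connected → ∀ t ∈ Φ.types, Φ.types = {t} → ∀ p : unitInterval, (p : ℝ) < 1 →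
      (∀ᵐ ω ∂bondPercolation G p, numInfiniteClusters ω ≤ 1) → Φ.CylSubcritical p → 0 < theta G t p →
        ∃ q : unitInterval, (q : ℝ) < p ∧ 0 < theta G t q

/-- The multi-type Neg node implies the single-type Neg node (forget the extra hypothesis). [folklore] -/
theorem samePDropOfSkeletonNeg₁_of_neg (h : SamePDropOfSkeletonNeg) : SamePDropOfSkeletonNeg₁ :=
  fun G _ Φ hc t ht _ p hp hU hC hθ => h G Φ hc t ht p hp hU hC hθ

/-- **The single-type Neg node implies the (closed) single-type Sign node** (forget the flip): N1's target subsumes D″'s target of record. [folklore] -/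
theorem samePDropOfSkeletonSign₁_of_neg₁ (h : SamePDropOfSkeletonNeg₁) : SamePDropOfSkeletonSign₁ :=
  fun G _ Φ hc t ht h1 p hp hU hC hθ => h G Φ.toPlanarSkeletonNeg hc t ht h1 p hp hU hC hθ

/-- **Normal form at criticality**: the single-type Neg node has content at `p = p_c` only. [cite: BenjaminiSchramm1996, Conj. 4] -/
theorem samePDropOfSkeletonNeg₁_iff_critical : SamePDropOfSkeletonNeg₁ ↔
    ∀ {V : Type} [DecidableEq V] [Countable V] (G : SimpleGraph V) [G.LocallyFinite] (Φ : PlanarSkeletonNeg G),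
      G.Connected → ∀ t ∈ Φ.types, Φ.types = {t} → criticalProb G t < 1 →
        (∀ᵐ ω ∂bondPercolation G (criticalProbIOf G t), numInfiniteClusters ω ≤ 1) →
          Φ.CylSubcritical (criticalProbIOf G t) → theta G t (criticalProbIOf G t) = 0 := by
  constructor
  · intro hD V _ _ G _ Φ hc t ht h1 hpc hU hC
    exact theta_criticalProbIOf_eq_zero_of_drop_at G t fun hpos => hD G Φ hc t ht h1 _ (by exact hpc) hU hC hpos
  · intro hK V _ _ G _ Φ hc t ht h1 p hp1 hU hC hθ
    have hge : criticalProb G t ≤ p :=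
      not_lt.1 fun hlt => hθ.ne' (theta_eq_zero_of_lt_criticalProb_holds G t p hlt)
    rcases hge.lt_or_eq with hlt | heq
    · have hpc0 : 0 ≤ criticalProb G t := (criticalProb_mem_Icc G t).1
      have hp0 : 0 ≤ (p : ℝ) := p.2.1
      have hq1 : (criticalProb G t + p) / 2 ≤ 1 := by linarith [p.2.2]
      refine ⟨⟨(criticalProb G t + p) / 2, by positivity, hq1⟩, ?_, ?_⟩
      · show (criticalProb G t + (p : ℝ)) / 2 < p
        linarith
      · exact theta_pos_of_criticalProb_lt_holds G t _
          (by show criticalProb G t < (criticalProb G t + (p : ℝ)) / 2; linarith)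
    · exfalso
      have e : p = criticalProbIOf G t := Subtype.ext heq.symm
      subst e
      exact hθ.ne' (hK G Φ hc t ht h1 (by exact hp1) hU hC)

/-- **The single-type Neg node in minimal form**: ↔ `θ_t(p_c) = 0` for every locally finite `G` with a one-type `PlanarSkeletonNeg` and Φ2 at
`p_c` — connectedness, countability, quasi-transitivity, uniqueness and `p_c < 1` are supplied by the skeleton (growth split: Hutchcroft /
Burton–Keane). [cite: BenjaminiSchramm1996, Conj. 4] [cite: Hutchcroft2016, Thm. 1] [cite: LyonsPeres2016, Thm. 7.6] -/
theorem samePDropOfSkeletonNeg₁_iff_minimal' : SamePDropOfSkeletonNeg₁ ↔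
    ∀ {V : Type} (G : SimpleGraph V) [G.LocallyFinite] (Φ : PlanarSkeletonNeg G), ∀ t ∈ Φ.types, Φ.types = {t} →
      Φ.CylSubcritical (criticalProbIOf G t) → theta G t (criticalProbIOf G t) = 0 := by
  rw [samePDropOfSkeletonNeg₁_iff_critical]
  constructor
  · intro hK V G _ Φ t ht h1 hC
    have hc : G.Connected := Φ.graph_connected t
    haveI : Countable V := countable_of_connected_of_locallyFinite G hc t
    have hq : IsQuasiTransitive G := Φ.isQuasiTransitive
    by_cases hg : HasExponentialGrowth G
    · exact Hutchcroft2016_noPercolationAtCriticality_holds G hc hq hg t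
    · have ha : IsGraphAmenable G := by_contra fun hna => hg (hasExponentialGrowth_of_not_isGraphAmenable G hq hna)
      exact hK G Φ hc t ht h1 (Φ.criticalProb_lt_one t) (BurtonKeane1989_atMostOneInfiniteCluster_holds G hc hq ha _) hC
  · intro h V _ _ G _ Φ _ t ht h1 _ _ hC
    exact h G Φ t ht h1 hC

/-- **ENTRY POINT OF THE N1 CLOSURE**: to prove the single-type Neg node it suffices to treat graphs NOT of exponential growth, one-type
skeletons, under Φ2 at `p_c`. [cite: Hutchcroft2016, Thm. 1] [cite: BenjaminiSchramm1996, Conj. 4] -/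
theorem samePDropOfSkeletonNeg₁_of_subexponential_case'
    (h : ∀ {V : Type} (G : SimpleGraph V) [G.LocallyFinite] (Φ : PlanarSkeletonNeg G), ¬ HasExponentialGrowth G →
      ∀ t ∈ Φ.types, Φ.types = {t} → Φ.CylSubcritical (criticalProbIOf G t) → theta G t (criticalProbIOf G t) = 0) :
    SamePDropOfSkeletonNeg₁ := by
  refine samePDropOfSkeletonNeg₁_iff_minimal'.2 fun G _ Φ t ht h1 hC => ?_
  by_cases hg : HasExponentialGrowth G
  · exact Hutchcroft2016_noPercolationAtCriticality_holds G (Φ.graph_connected t)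
      Φ.isQuasiTransitive hg t
  · exact h G Φ hg t ht h1 hC

/-- **Conditional continuity from the single-type Neg node** (the instances' one-liner): one type, Φ2 at `p_c` ⟹ `θ_t(p_c) = 0`.
[cite: BenjaminiSchramm1996, Conj. 4] -/
theorem continuity_of_negNode₁ (hD : SamePDropOfSkeletonNeg₁) {V : Type} (G : SimpleGraph V) [G.LocallyFinite]
    (Φ : PlanarSkeletonNeg G) {t : V} (ht : t ∈ Φ.types) (h1 : Φ.types = {t}) (hC : Φ.CylSubcritical (criticalProbIOf G t)) :
    theta G t (criticalProbIOf G t) = 0 :=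
  samePDropOfSkeletonNeg₁_iff_minimal'.1 hD G Φ t ht h1 hC

end Summit.CriticalPhenomena.PercolationContinuityZ3.Theorems.Transplant

end
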